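import Literature.Analysis.FluidPDE.PassiveVectorTensor
import Summits.AnomalousDissipation.AnomalousDissipation.Theorems.IsotropicCubatureWord

/-!
# K1L `LagrangianRenormalisationStep` (stmt-AnomalousDissipation-24912) — crux idea `shape-map-spectral-certificate`
(planner ad-ideate-p5 gen 2, lens «profile» = profile-and-certify), SKETCH of the typed statements.

The tracking half of `stub_chainL` (F16-3 target `AnisotropyWindow W M c B` of the registered K1L skeleton
`HOME/ad-ideate-p1/r17/LagrangianRenormalisationStep_birth_v9_lit_tree.lean`) asks that the orbit of the one-level SHAPE MAP of
the 26-slot cubature word — `taylorShape W M c ν S = (S + excShape W M S/ν²)/(1 + c/ν²)`, `excShape` = p1's quasi-static excess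
tensor with slot correctors `Q_s(S) = [P_s Σ(S, m̂_s) P_s]⁺` — stays in ONE transverse window under summable relative
perturbations.  PROFILE-AND-CERTIFY: linearise the normalised long-slot excess map `Excn` (`ϑ_s ≡ 1/3`, the common limit of the
realised slot weights; finite-M spread ≤ 4.8·10⁻⁶/M² (kit j300474)) at the isotropic point.  Its derivative `L = D Excn(I)` is the EXPLICIT RATIONAL
operator `linShape` below (81 × 81 over ℚ, denominators ≤ 126, 15 distinct entries), and EXACT rational arithmetic (folder
`k1l/exact_minpoly.py`; kit j300194) proves:
* `L` preserves major symmetry / antisymmetry;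
* on MAJOR-SYMMETRIC tensors its minimal polynomial is `x(x+1)(x²+x/3−4/21)(x−5/21)(x−4/21)(x−1/6)(x−1/9)(x−1/21)` (simple roots ⇒
  diagonalisable), multiplicities `0:18, −1:1 (the isotropic ray, reflected: AV's x ↦ 1/x), (−1±√(55/7))/6 = −0.6338…/+0.3005…: 5+5,
  5/21:7, 4/21:1, 1/6:2, 1/9:3, 1/21:3` — so the ANISOTROPIC spectral radius is `(1+√(55/7))/6 = 0.63384…`;
* on MAJOR-ANTISYMMETRIC ("odd-viscosity") tensors the minimal polynomial is `x(x+1/3)(x−1/7)`, multiplicities `0:26, −1/3:3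
  (span of L J_u, J_u := ε_{uij}δ_{ab} the isotropic odd tensors: L J_u ≡ −J_u/3 mod transverse-invisible tensors, exact), 1/7:7` — odd parts CONTRACT by ≥ 3× per large-gain step at linear order (bears on the v8 window clause
  `OddSmall S β → OddSmall (Φ S) β`, F17-1c).
Consequences typed here: the reflection of the isotropic ray (`IsoReflected`), the two minimal-polynomial identities
(`EvenMinpoly`, `OddMinpoly`), `linShape` IS the derivative of the normalised long-slot map (`DerivIsLinShape`), the LINEARISED
WINDOW with an explicit Lyapunov constant (`LinearisedWindow Mw`; kit j300663: `Σ_λ ‖Π_λ‖_W = 10.04` by LP, products of level maps sampled ≤ 1.004), and the quantitative nonlinear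
window for the long-slot model map (`ModelAnisotropyWindow`).  Nothing here is proved; every item elaborates.
-/

set_option linter.dupNamespace false

namespace Summit.AnomalousDissipation.AnomalousDissipation.Cruxes.LagrangianRenormalisationStep.ShapeMapSpectrum

open Literature.Analysis.FluidPDE Literature.Analysis.FluidPDE.Torus
open Summit.AnomalousDissipation.AnomalousDissipation.Theorems (SlotData slots)
open scoped Topology

noncomputable section

/-! ## §0 Rational slot data of the cubature word (from the tree's `Theorems.IsotropicCubatureWord.slots`) -/

/-- `|m|²` of a slot (an integer). -/
def mSq (d : SlotData) : ℤ := d.m 0 ^ 2 + d.m 1 ^ 2 + d.m 2 ^ 2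

/-- `m̂_a m̂_b = m_a m_b / |m|²` (rational). -/
def mm (d : SlotData) (a b : Fin 3) : ℝ := ((d.m a * d.m b : ℤ) : ℝ) / ((mSq d : ℤ) : ℝ)

/-- `e_a e_b = v_a v_b / n` (rational). -/
def ee (d : SlotData) (a b : Fin 3) : ℝ := ((d.v a * d.v b : ℤ) : ℝ) / (d.n : ℝ)

/-- The transverse projection `P = I − m̂ m̂ᵀ` of a slot (rational). -/
def proj (d : SlotData) (i j : Fin 3) : ℝ := (if i = j then 1 else 0) - mm d i j

/-- Slot weight `τ/|m|⁴` (= cubature weight 40 : 32 : 27; the common factor `ϑ/(2(2π)⁴ period)` cancels in the normalisation). -/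
def wt (d : SlotData) : ℝ := (d.τ : ℝ) / (((mSq d : ℤ) : ℝ) ^ 2)

/-- The background symbol at the slot direction, `Σ(S, m̂)_{ij} = Σ_{ab} S i a j b m̂_a m̂_b`. -/
def sig (d : SlotData) (S : Visc4 (Fin 3)) (i j : Fin 3) : ℝ := ∑ a, ∑ b, S i a j b * mm d a b

/-- The transverse block `(P Σ(H, m̂) P)_{ij}` of `H` at the slot direction. -/
def block (d : SlotData) (H : Visc4 (Fin 3)) (i j : Fin 3) : ℝ :=
  ∑ i', ∑ j', proj d i i' * sig d H i' j' * proj d j' j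

/-- The realised isotropic constant of the word in weight units: `Σ_s wt_s (e_s·q)² |P_s p|² = 168 |q|²|p|²` for `p ⊥ q`
(`IsotropicCubatureWord`: `168/(32π⁴) = c₀ · period`). -/
def cR : ℝ := 168

/-! ## §1 The linearised shape map and the long-slot model map -/

/-- **`L = D Excn(I)`**, the derivative at the isotropic point of the normalised long-slot excess map:
`(L H)_{iajb} = −(1/168) Σ_s wt_s (e_s)_a (e_s)_b (P_s Σ(H, m̂_s) P_s)_{ij}`  (from `d/dt [P Σ(I + tH) P]⁺ = −P Σ(H) P` on `m̂^⊥`). -/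
def linShape (H : Visc4 (Fin 3)) : Visc4 (Fin 3) := fun i a j b =>
  -(1 / cR) * ∑ s : Fin 26, wt (slots s) * ee (slots s) a b * block (slots s) H i j

/-- The slot corrector matrix `Q_s(S) = (P Σ(S,m̂) P + m̂ m̂ᵀ)⁻¹ P` (pseudo-inverse of the transverse block; p1's `excShape` formula). -/
def corrQ (d : SlotData) (S : Visc4 (Fin 3)) : Matrix (Fin 3) (Fin 3) ℝ :=
  (Matrix.of (fun i j => block d S i j + mm d i j))⁻¹ * Matrix.of (fun i j => proj d i j)

/-- The NORMALISED LONG-SLOT EXCESS MAP `Excn(S)_{iajb} = (1/168) Σ_s wt_s (e_s)_a (e_s)_b Q_s(S)_{ij}` (= `excShape W M S / (c_W)`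
with every realised slot weight `ϑ_s` replaced by its common long-slot limit `1 − 4·ramp/3 = 1/3`; homogeneous of degree `−1`;
`Excn(I) = I` on transverse symbols). -/
def excnShape (S : Visc4 (Fin 3)) : Visc4 (Fin 3) := fun i a j b =>
  (1 / cR) * ∑ s : Fin 26, wt (slots s) * ee (slots s) a b * corrQ (slots s) S i j

/-- The long-slot MODEL of the one-level shape map at relative gain `γ = c/ν²`: the convex combination `(S + γ Excn S)/(1 + γ)`
(`taylorShape` with `ϑ_s ≡ 1/3`). -/
def modelStep (γ : ℝ) (S : Visc4 (Fin 3)) : Visc4 (Fin 3) := (1 / (1 + γ)) • (S + γ • excnShape S)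

/-- Horner evaluation of a polynomial in `L` applied to `H`: `horner [c₀, c₁, …, c_n] H = c₀ H + L (c₁ H + L (… + L (c_n H)))`. -/
def horner : List ℝ → Visc4 (Fin 3) → Visc4 (Fin 3)
  | [], _ => 0
  | c :: cs, H => c • H + linShape (horner cs H)

/-! ## §2 The certified spectral facts (exact rational arithmetic; kernel path: `norm_num`/`decide` over the explicit 81×81 rational
matrix, or eigenvector-by-eigenvector) -/

/-- The isotropic ray is REFLECTED: `symb (L I) = − symb I` on transverse pairs (degree −1 homogeneity + isotropy of the word). -/
def IsoReflected : Prop :=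
  ∀ q p : Fin 3 → ℝ, ∑ i, p i * q i = 0 → symb (linShape (isoVisc 1)) q p = -symb (isoVisc (1 : ℝ) : Visc4 (Fin 3)) q p

/-- **Even minimal polynomial.**  On major-symmetric tensors, `p_e(L) = 0` with
`p_e(x) = x(x+1)(x²+x/3−4/21)(x−5/21)(x−4/21)(x−1/6)(x−1/9)(x−1/21)`
`= x⁹ + (73/126)x⁸ − (1709/2646)x⁷ − (1075/27783)x⁶ + (11450/83349)x⁵ − (150677/3500658)x⁴ + (60667/10501974)x³ − (88/250047)x² + (40/5250987)x`
(verified in exact arithmetic, each factor necessary; multiplicities 0:18, −1:1, quadratic pair 5+5, 5/21:7, 4/21:1, 1/6:2, 1/9:3, 1/21:3). -/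
def EvenMinpoly : Prop :=
  ∀ H : Visc4 (Fin 3), MajorSymm H →
    horner [0, 40/5250987, -(88/250047), 60667/10501974, -(150677/3500658), 11450/83349, -(1075/27783), -(1709/2646), 73/126, 1] H = 0

/-- **Odd minimal polynomial.**  On major-ANTISYMMETRIC tensors (`H i a j b = −H j b i a`), `L(L + 1/3)(L − 1/7) = 0`
(multiplicities 0:26, −1/3:3, 1/7:7): odd ("precession") parts are contracted at least threefold per large-gain step. -/
def OddMinpoly : Prop :=
  ∀ H : Visc4 (Fin 3), (∀ i a j b, H i a j b = -H j b i a) → horner [0, -(1/21), 4/21, 1] H = 0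

/-- `linShape` is the derivative of the normalised long-slot excess map at the isotropic point (directional form). -/
def DerivIsLinShape : Prop :=
  ∀ H : Visc4 (Fin 3), Filter.Tendsto (fun t : ℝ => t⁻¹ • (excnShape (isoVisc 1 + t • H) - excnShape (isoVisc 1)))
    (𝓝[≠] 0) (𝓝 (linShape H))

/-! ## §3 The certified LINEARISED WINDOW (Lyapunov norm from diagonalisability; constant measured by kit j300378) -/

/-- **Linearised window with constant `Mw`.**  Every orbit of the linearised level maps `H ↦ (H + γ_i L H)/(1 + γ_i)` (ARBITRARY gains
`γ_i ≥ 0`) driven by transverse-symbol perturbations of sizes `ε_i` stays, in transverse-symbol seminorm, within `Mw·(h₀ + Σ_{i<n} ε_i)`: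
all eigen-multipliers `(1 + γλ)/(1 + γ)`, `λ ∈ spec_even`, have modulus ≤ 1, and `Mw = Σ_λ ‖Π_λ‖_{W→W}` (spectral projectors) works. -/
def LinearisedWindow (Mw : ℝ) : Prop :=
  ∀ (H E : ℕ → Visc4 (Fin 3)) (γ ε : ℕ → ℝ) (h₀ : ℝ),
    (∀ i, MajorSymm (H i)) → (∀ i, 0 ≤ γ i) → (∀ i, 0 ≤ ε i) →
    (∀ q p : Fin 3 → ℝ, ∑ i, q i ^ 2 = 1 → ∑ i, p i ^ 2 = 1 → ∑ i, p i * q i = 0 → |symb (H 0) q p| ≤ h₀) →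
    (∀ n, ∀ q p : Fin 3 → ℝ, ∑ i, q i ^ 2 = 1 → ∑ i, p i ^ 2 = 1 → ∑ i, p i * q i = 0 → |symb (E n) q p| ≤ ε n) →
    (∀ n, H (n + 1) = (1 / (1 + γ n)) • (H n + γ n • linShape (H n)) + E n) →
    ∀ n, ∀ q p : Fin 3 → ℝ, ∑ i, q i ^ 2 = 1 → ∑ i, p i ^ 2 = 1 → ∑ i, p i * q i = 0 →
      |symb (H n) q p| ≤ Mw * (h₀ + ∑ i ∈ Finset.range n, ε i)

/-- The odd analogue: orbits of major-antisymmetric parts under the linearised level maps, measured in the odd transverse seminorm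
`|bsymb H k p q − bsymb H k q p|` (`OddSmall`), stay within `Mo·(h₀ + Σ ε_i)` — the linearised form of the v8 clause `OddSmall S β → OddSmall (Φ S) β`. -/
def LinearisedOddWindow (Mo : ℝ) : Prop :=
  ∀ (H E : ℕ → Visc4 (Fin 3)) (γ ε : ℕ → ℝ) (h₀ : ℝ),
    (∀ n i a j b, H n i a j b = -H n j b i a) → (∀ i, 0 ≤ γ i) → (∀ i, 0 ≤ ε i) →
    (∀ k p q : Fin 3 → ℝ, ∑ i, k i ^ 2 = 1 → ∑ i, p i ^ 2 = 1 → ∑ i, q i ^ 2 = 1 → ∑ i, p i * k i = 0 → ∑ i, q i * k i = 0 →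
        |bsymb (H 0) k p q - bsymb (H 0) k q p| ≤ h₀) →
    (∀ n, ∀ k p q : Fin 3 → ℝ, ∑ i, k i ^ 2 = 1 → ∑ i, p i ^ 2 = 1 → ∑ i, q i ^ 2 = 1 → ∑ i, p i * k i = 0 → ∑ i, q i * k i = 0 →
        |bsymb (E n) k p q - bsymb (E n) k q p| ≤ ε n) →
    (∀ n, H (n + 1) = (1 / (1 + γ n)) • (H n + γ n • linShape (H n)) + E n) →
    ∀ n, ∀ k p q : Fin 3 → ℝ, ∑ i, k i ^ 2 = 1 → ∑ i, p i ^ 2 = 1 → ∑ i, q i ^ 2 = 1 → ∑ i, p i * k i = 0 → ∑ i, q i * k i = 0 →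
      |bsymb (H n) k p q - bsymb (H n) k q p| ≤ Mo * (h₀ + ∑ i ∈ Finset.range n, ε i)

/-! ## §4 The quantitative NONLINEAR window for the long-slot model map (F16-3 made explicit for the cubature word) -/

/-- **Model anisotropy window.**  There are `B₀ > 0` and `Mw` such that for every budget `B ≤ B₀`: every sequence of MAJOR-SYMMETRIC shape
tensors starting at `I`, each within relative transverse-symbol distance `δ_i` of the model image of its predecessor (arbitrary gains
`γ_i ≥ 0`), with `Σ δ_i ≤ B`, satisfies `NearIso (S i) (1 − Mw·B) (1 + Mw·B)` for all `i` — the window of `AnisotropyWindow W M c B` made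
explicit (linear in `B`; second-order remainder of the rational map `Q_s` absorbed for `B ≤ B₀`: `‖D²Q‖ ≤ 2/lo³`). -/
def ModelAnisotropyWindow : Prop :=
  ∃ B₀ > (0 : ℝ), ∃ Mw : ℝ, 0 ≤ Mw ∧ ∀ B : ℝ, 0 ≤ B → B ≤ B₀ →
    ∀ (S : ℕ → Visc4 (Fin 3)) (γ δ : ℕ → ℝ),
      S 0 = isoVisc 1 → (∀ i, MajorSymm (S i)) → (∀ i, 0 ≤ γ i) → (∀ i, 0 ≤ δ i) →
      (∀ n, ∑ i ∈ Finset.range n, δ i ≤ B) →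
      (∀ i, ∀ q p : Fin 3 → ℝ, ∑ l, p l * q l = 0 →
        |symb (S (i + 1)) q p - symb (modelStep (γ i) (S i)) q p| ≤ δ i * symb (modelStep (γ i) (S i)) q p) →
      ∀ i, NearIso (S i) (1 - Mw * B) (1 + Mw * B)

/-! ## §5 Sanity: the objects compute against the tree's word -/

example : (slots 0).τ = 40 := by decide
example : cR = 168 := rfl

end

end Summit.AnomalousDissipation.AnomalousDissipation.Cruxes.LagrangianRenormalisationStep.ShapeMapSpectrum
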